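import Summits.KontsevichZagierPeriods.KontsevichZagierPeriods.Theorems.IsometryMove.Negative.Kit

/-!
# `IsometryMove` (stmt-KontsevichZagierPeriods-3471) — negative side III: tightness

The height normalisation `‖ad − bc‖ t / N` and the density exponent `3` admit no variation:
`not_isometryMoveHeightScale κ` (height `κ‖ad − bc‖`, EVERY rational `κ ≠ 1`; anchor `κ = 1`),
`not_isometryMoveUnnormalised` (textbook `SL₂` height `t/N` without the factor `‖ad − bc‖`),
`not_isometryMoveWithExponent k` (density `t^{-k}`, EVERY `k ≠ 3`, incl. the half-PLANE density
`t⁻²` and Lebesgue volume; anchor `k = 3`). Each is one diagonal witness fed to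
`gen_false_of_diag`. [Kontsevich–Zagier 2001, §1.2; Benedetti–Petronio 1992, §A.4]
-/

noncomputable section

open MeasureTheory Set MvPolynomial intervalIntegral
open Literature.NumberTheory.Transcendental Literature.ModelTheory.ExponentialFields

namespace Summit.KontsevichZagierPeriods.HyperbolicBloch.IsometryMoveNegative

open Summit.KontsevichZagierPeriods.KontsevichZagierPeriods (Theses.HyperbolicBloch.IsometryMove)

/-! ## §3 Tightness: the height normalisation `‖ad − bc‖` and the exponent `3` admit no change

Natural strengthenings / mis-formulations, each refuted by a diagonal witness:
* `IsometryMoveHeightScale κ` — height numerator `κ‖ad − bc‖`; true member `κ = 1` (the crux);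
  FALSE for every rational `κ ≠ 1` (the conformal factor of a hyperbolic isometry is forced).
* `IsometryMoveUnnormalised` — height numerator `1` (the `SL₂`-normalised textbook formula
  `t/N` used WITHOUT normalising `ad − bc = 1`); FALSE (witness `a = 2`).
* `IsometryMoveWithExponent k` — density `t^{-k}`; true member `k = 3` (the crux, hyperbolic
  volume `dx dy dt / t³`); FALSE for every `k ≠ 3` (witness: the homothety `a = 2, d = 1`, which
  rescales the value by `2^{3-k}`). -/

/-- The crux with height numerator `κ * ‖a d − b c‖` in place of `‖a d − b c‖`. [folklore] -/
def IsometryMoveHeightScale (κ : ℝ) : Prop :=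
  IsometryMoveGen CruxAdm (fun a b c d => κ * ‖a * d - b * c‖) 3

/-- The crux with height numerator `1` in place of `‖a d − b c‖` (unnormalised `SL₂` formula). -/
def IsometryMoveUnnormalised : Prop :=
  IsometryMoveGen CruxAdm (fun _ _ _ _ => 1) 3

/-- The crux with density `t^{-k}` in place of `t^{-3}` (on both representations). [folklore] -/
def IsometryMoveWithExponent (k : ℕ) : Prop :=
  IsometryMoveGen CruxAdm cruxHeight k

/-- ANCHOR: `κ = 1` is the crux. [folklore] -/
theorem isometryMove_iff_heightScale_one :
    Theses.HyperbolicBloch.IsometryMove ↔ IsometryMoveHeightScale 1 := by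
  rw [isometryMove_iff_gen, IsometryMoveHeightScale]
  have : (fun a b c d : ℂ => (1 : ℝ) * ‖a * d - b * c‖) = cruxHeight := by
    funext a b c d; simp [cruxHeight]
  rw [this]

/-- ANCHOR: `k = 3` is the crux. [folklore] -/
theorem isometryMove_iff_withExponent_three :
    Theses.HyperbolicBloch.IsometryMove ↔ IsometryMoveWithExponent 3 :=
  isometryMove_iff_gen

/-- **The height normalisation is rigid.** For every rational `κ ≠ 1` the `κ`-scaled statement is
false. Witness `a = d = 1`, `b = c = 0`, `ε = 1`: the typed map is `(x, y, t) ↦ (x, y, κt)`; for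
`κ > 0` the unit box `(0,1)² × (1,2)` goes to `(0,1)² × (κ, 2κ)` whose `t⁻³`-value is `κ⁻²` times the
original (substitution `t = κs`); for `κ < 0` the image lies in `{t < 0}` and has negative value; for
`κ = 0` it is a null square in the plane `t = 0`. [folklore] -/
theorem not_isometryMoveHeightScale (κ : ℚ) (hκ : κ ≠ 1) : ¬ IsometryMoveHeightScale κ := by
  have hI := integral_powInv_pos 3 (zero_lt_one' ℝ) one_lt_two
  rcases lt_trichotomy κ 0 with hκ0 | rfl | hκ0
  · -- κ < 0 : image (0,1)² × (2κ, κ) ⊆ {t < 0}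
    have hκR : (κ : ℝ) < 0 := by exact_mod_cast hκ0
    refine gen_false_of_diag 1 1 (by simpa using isAlgebraic_one)
      (cruxAdm_diag one_ne_zero (Or.inl rfl)) ![1, 1, κ]
      (by funext i; fin_cases i <;> simp) (unitBoxRep 3)
      (boxRep 3 ![0, 0, 2 * κ] ![1, 1, κ] (Or.inr (by simpa using hκ0)))
      (unitBoxRep_domain_subset 3) (fun _ _ => rfl) ?_ (fun _ _ => rfl) ?_
    · rw [boxRep_domain, unitBoxRep, boxRep_domain, box, box, diagMap_image_pi]
      refine pi_eq_pi ?_ ?_ ?_ <;> simp [image_mul_left_Ioo_of_neg hκR]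
      ring_nf
    · rw [value_unitBoxRep,
        value_boxRep 3 _ _ _ (fun i => by fin_cases i <;> simp; linarith)]
      simp only [Matrix.cons_val_zero, Matrix.cons_val_one, Matrix.head_cons, Matrix.cons_val_two,
        Matrix.tail_cons, Rat.cast_one, Rat.cast_zero, Rat.cast_mul, Rat.cast_ofNat, sub_zero,
        one_mul]
      -- ∫_{2κ}^{κ} = κ · κ⁻³ · ∫_2^1 = -(κ · κ⁻³ · I) < 0 < I
      have hB : ∫ t in (2 * (κ : ℝ))..κ, 1 / t ^ 3 =
          -((κ : ℝ) * (1 / (κ : ℝ) ^ 3 * ∫ t in (1 : ℝ)..2, 1 / t ^ 3)) := by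
        have := integral_powInv_scale 3 (κ : ℝ) 2 1
        rw [mul_one, mul_comm (κ : ℝ) 2, intervalIntegral.integral_symm (1 : ℝ) 2] at this
        rw [this]; ring
      have h3 : (1 : ℝ) / (κ : ℝ) ^ 3 < 0 := by
        rw [one_div_neg]; exact Odd.pow_neg (by decide) hκR
      have : 0 < (κ : ℝ) * (1 / (κ : ℝ) ^ 3 * ∫ t in (1 : ℝ)..2, 1 / t ^ 3) :=
        mul_pos_of_neg_of_neg hκR (mul_neg_of_neg_of_pos h3 hI)
      rw [hB]
      intro h
      linarith
  · -- κ = 0 : image is the null square (0,1)² × {0}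
    refine gen_false_of_diag 1 1 (by simpa using isAlgebraic_one)
      (cruxAdm_diag one_ne_zero (Or.inl rfl)) ![1, 1, 0]
      (by funext i; fin_cases i <;> simp) (unitBoxRep 3)
      (nullRep 3 (Set.pi univ ![Ioo (0 : ℝ) 1, Ioo 0 1, {0}])
        (isSemialgebraic_pi _ fun i => by
          fin_cases i
          · simpa using isSemialgebraic_coord_Ioo 0 0 1
          · simpa using isSemialgebraic_coord_Ioo 1 0 1
          · simpa using isSemialgebraic_coord_singleton 2 0)
        (isSemialgebraicFunOn_powDensity_of_eq_zero
          (isSemialgebraic_pi _ fun i => by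
            fin_cases i
            · simpa using isSemialgebraic_coord_Ioo 0 0 1
            · simpa using isSemialgebraic_coord_Ioo 1 0 1
            · simpa using isSemialgebraic_coord_singleton 2 0)
          (fun p hp => by simpa using (mem_univ_pi.mp hp) 2) three_ne_zero)
        (volume_pi_eq_zero 2 (by simp)))
      (unitBoxRep_domain_subset 3) (fun _ _ => rfl) ?_ (fun _ _ => rfl) ?_
    · rw [nullRep_domain, unitBoxRep, boxRep_domain, box, diagMap_image_pi]
      refine pi_eq_pi ?_ ?_ ?_ <;> simp
    · rw [value_nullRep]
      exact (value_unitBoxRep_pos 3).ne'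
  · -- 0 < κ : image (0,1)² × (κ, 2κ)
    have hκR : (0 : ℝ) < κ := by exact_mod_cast hκ0
    refine gen_false_of_diag 1 1 (by simpa using isAlgebraic_one)
      (cruxAdm_diag one_ne_zero (Or.inl rfl)) ![1, 1, κ]
      (by funext i; fin_cases i <;> simp) (unitBoxRep 3)
      (boxRep 3 ![0, 0, κ] ![1, 1, 2 * κ] (Or.inl (by simpa using hκ0)))
      (unitBoxRep_domain_subset 3) (fun _ _ => rfl) ?_ (fun _ _ => rfl) ?_
    · rw [boxRep_domain, unitBoxRep, boxRep_domain, box, box, diagMap_image_pi]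
      refine pi_eq_pi ?_ ?_ ?_ <;> simp [image_mul_left_Ioo hκR]
      ring_nf
    · rw [value_unitBoxRep,
        value_boxRep 3 _ _ _ (fun i => by fin_cases i <;> simp; linarith)]
      simp only [Matrix.cons_val_zero, Matrix.cons_val_one, Matrix.head_cons, Matrix.cons_val_two,
        Matrix.tail_cons, Rat.cast_one, Rat.cast_zero, Rat.cast_mul, Rat.cast_ofNat, sub_zero,
        one_mul]
      have hB : ∫ t in (κ : ℝ)..(2 * κ), 1 / t ^ 3 =
          (κ : ℝ) * (1 / (κ : ℝ) ^ 3 * ∫ t in (1 : ℝ)..2, 1 / t ^ 3) := by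
        have := integral_powInv_scale 3 (κ : ℝ) 1 2
        rwa [mul_one, mul_comm (κ : ℝ) 2] at this
      rw [hB]
      intro h
      -- I = κ · κ⁻³ · I with I > 0 forces κ³ = κ, i.e. κ = 1 since κ > 0
      have hκ3 : (κ : ℝ) ^ 3 ≠ 0 := pow_ne_zero 3 hκR.ne'
      have hk1 : (1 : ℝ) = (κ : ℝ) * (1 / (κ : ℝ) ^ 3) :=
        mul_right_cancel₀ hI.ne' (by rw [one_mul, mul_assoc]; exact h)
      have e1 : (κ : ℝ) ^ 3 = κ := by
        have := congrArg (· * (κ : ℝ) ^ 3) hk1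
        rw [one_mul, mul_assoc, one_div, inv_mul_cancel₀ hκ3, mul_one] at this
        exact this
      have h5 : ((κ : ℝ) - 1) * ((κ : ℝ) * (κ + 1)) = 0 := by linear_combination e1
      rcases mul_eq_zero.mp h5 with h5 | h5
      · exact hκ (by exact_mod_cast (sub_eq_zero.mp h5))
      · exact absurd h5 (mul_pos hκR (by linarith)).ne'

/-- **The crux is tight in the height numerator:** dropping `‖ad − bc‖` (the unnormalised `SL₂`
formula `t / N`) is false. Witness `a = 2, d = 1, b = c = 0, ε = 1`: the typed map is then
`(x, y, t) ↦ (2x, 2y, t)`, which multiplies the value of the unit box by `4`. [folklore] -/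
theorem not_isometryMoveUnnormalised : ¬ IsometryMoveUnnormalised := by
  have hI := integral_powInv_pos 3 (zero_lt_one' ℝ) one_lt_two
  refine gen_false_of_diag 2 1 (by simpa using isAlgebraic_nat (R := ℚ) (A := ℂ) 2)
    (cruxAdm_diag two_ne_zero (Or.inl rfl)) ![2, 2, 1]
    (by funext i; fin_cases i <;> simp) (unitBoxRep 3)
    (boxRep 3 ![0, 0, 1] ![2, 2, 2] (Or.inl (by simp)))
    (unitBoxRep_domain_subset 3) (fun _ _ => rfl) ?_ (fun _ _ => rfl) ?_
  · rw [boxRep_domain, unitBoxRep, boxRep_domain, box, box, diagMap_image_pi]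
    refine pi_eq_pi ?_ ?_ ?_ <;> simp [image_mul_left_Ioo (zero_lt_two' ℝ)]
  · rw [value_unitBoxRep, value_boxRep 3 _ _ _ (fun i => by fin_cases i <;> simp)]
    simp only [Matrix.cons_val_zero, Matrix.cons_val_one, Matrix.head_cons, Matrix.cons_val_two,
      Matrix.tail_cons, Rat.cast_one, Rat.cast_zero, Rat.cast_ofNat, sub_zero]
    intro h
    linarith

/-- **The exponent `3` is rigid.** For every `k ≠ 3` the statement with density `t^{-k}` is false.
Witness: the homothety `a = 2, d = 1, b = c = 0, ε = 1`, typed map `p ↦ 2p`, which IS a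
hyperbolic isometry; it sends the unit box `(0,1)² × (1,2)` to `(0,2)² × (2,4)` and the value
`∫ t^{-k}` from `I` to `4 · ∫_2^4 t^{-k} dt = 2^{3-k} I` (substitution `t = 2s`), `I > 0`. [folklore] -/
theorem not_isometryMoveWithExponent (k : ℕ) (hk : k ≠ 3) : ¬ IsometryMoveWithExponent k := by
  have hI := integral_powInv_pos k (zero_lt_one' ℝ) one_lt_two
  refine gen_false_of_diag 2 1 (by simpa using isAlgebraic_nat (R := ℚ) (A := ℂ) 2)
    (cruxAdm_diag two_ne_zero (Or.inl rfl)) ![2, 2, 2]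
    (by funext i; fin_cases i <;> simp [cruxHeight]) (unitBoxRep k)
    (boxRep k ![0, 0, 2] ![2, 2, 4] (Or.inl (by simp)))
    (unitBoxRep_domain_subset k) (fun _ _ => rfl) ?_ (fun _ _ => rfl) ?_
  · rw [boxRep_domain, unitBoxRep, boxRep_domain, box, box, diagMap_image_pi]
    refine pi_eq_pi ?_ ?_ ?_
    · simp [image_mul_left_Ioo (zero_lt_two' ℝ)]
    · simp [image_mul_left_Ioo (zero_lt_two' ℝ)]
    · simp only [image_mul_left_Ioo (zero_lt_two' ℝ), Matrix.cons_val_two, Matrix.tail_cons,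
        Matrix.head_cons, Rat.cast_ofNat]
      norm_num
  · rw [value_unitBoxRep, value_boxRep k _ _ _ (fun i => by fin_cases i <;> norm_num)]
    simp only [Matrix.cons_val_zero, Matrix.cons_val_one, Matrix.head_cons, Matrix.cons_val_two,
      Matrix.tail_cons, Rat.cast_zero, Rat.cast_ofNat, sub_zero]
    have hB : ∫ t in (2 : ℝ)..4, 1 / t ^ k = 2 * (1 / (2 : ℝ) ^ k * ∫ t in (1 : ℝ)..2, 1 / t ^ k) := by
      have := integral_powInv_scale k (2 : ℝ) 1 2
      rwa [show (2 : ℝ) * 1 = 2 by norm_num, show (2 : ℝ) * 2 = 4 by norm_num] at this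
    rw [hB]
    intro h
    -- I = 8 · 2^{-k} · I with I > 0 forces 2^k = 8
    have h2k : (2 : ℝ) ^ k ≠ 0 := pow_ne_zero k two_ne_zero
    have h' : (2 : ℝ) ^ k * (∫ t in (1 : ℝ)..2, 1 / t ^ k) = 8 * ∫ t in (1 : ℝ)..2, 1 / t ^ k := by
      have e := congrArg (fun x => (2 : ℝ) ^ k * x) h
      rw [e]
      field_simp
      ring
    have h8 : (2 : ℝ) ^ k = 2 ^ 3 := by
      have := mul_right_cancel₀ hI.ne' h'
      rw [this]; norm_num
    exact hk (Nat.pow_right_injective (le_refl 2) (by exact_mod_cast h8))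

/-- Named instances of §3 for quick citation: reflecting into the lower half-space (`κ = −1`,
`t⁻³` is odd so the value changes sign), collapsing the height (`κ = 0`), doubling it (`κ = 2`);
the upper-half-PLANE density `t⁻²` and Lebesgue volume `t⁰` in place of `t⁻³`. [folklore] -/
theorem tightness_instances :
    ¬ IsometryMoveHeightScale (-1) ∧ ¬ IsometryMoveHeightScale 0 ∧ ¬ IsometryMoveHeightScale 2 ∧
      ¬ IsometryMoveWithExponent 2 ∧ ¬ IsometryMoveWithExponent 0 := by
  refine ⟨?_, ?_, ?_, not_isometryMoveWithExponent 2 (by decide),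
    not_isometryMoveWithExponent 0 (by decide)⟩
  · simpa using not_isometryMoveHeightScale (-1) (by norm_num)
  · simpa using not_isometryMoveHeightScale 0 (by norm_num)
  · simpa using not_isometryMoveHeightScale 2 (by norm_num)

end Summit.KontsevichZagierPeriods.HyperbolicBloch.IsometryMoveNegative

end
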